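import Mathlib
import Literature.Analysis.FluidPDE.VectorCalculus
import Summits.NavierStokesRegularity.NavierStokesRegularity.Theorems.FilamentSkeletonRssClause13RSlipAdjoint
import Summits.NavierStokesRegularity.NavierStokesRegularity.Theorems.FilamentSkeletonRssClause13RPairIntegrated

/-!
# Clause 13-R, route (ii′) item (a), part 5: the PER-FILAMENT ADJOINT IDENTITY for the closed form of `DT·Y_j`, paired with a `C¹` weight over `S_j`
# (crux `Clause13RNearStraightL`, stmt-NavierStokesRegularity-23612; line `rate_bordered_split`, STUB R `stub_rateRow13RFlat`)

Route `FilamentSkeletonRss`, Variant A1R.  The closed form of the linearised normal-velocity map at an in-ball station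
(`…Clause13LinearisedMapClauses.deriv_linearisedMap_inBall`) is
`E_j(τ) = (V − ⟪V, X_j′τ⟫X_j′τ) + (w_jτ⟪X_j′τ, Y_j′τ⟫)X_j′τ − w_jτ Y_j′τ`, `V = Σ_k c_k • ∫ I_{jk}(τ,σ) dσ + ½Y_jτ − α e₃ × Y_jτ`
(`c_k = Γγ_k/4π`, `I_{jk}` the variation kernel of `…Clause13RPairwiseAdjoint`).  THIS FILE pairs `E_j` with a `C¹` weight `ψ_j` over the compact ball
`S_j = {τ : ‖X_jτ‖ ≤ ℓ}` and moves EVERYTHING onto the test fields: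

`∫_{S_j} ⟪ψ_jτ, E_j(τ)⟫ dτ = Σ_k c_k (∫_{S_j} ⟪A_{jk}, Y_j⟫ + ∫ ⟪B_{jk}, Y_k⟫ − ∫ ⟪C_{jk}, Y_k⟫) + ∫_{S_j} ⟪½φ_j + α e₃ × φ_j, Y_j⟫ + ∫_{S_j} ⟪w_j′•φ_j + w_j•φ_j′, Y_j⟫`

(`setIntegral_inner_closedForm_eq`), where `φ_j = ψ_j − ⟪ψ_j, X_j′⟫X_j′` is the normal projection of the weight, `A, B, C` are the explicit adjoint weights
of `…Clause13RPairIntegrated`, and the last term is the slip adjoint of `…Clause13RSlipAdjoint` (`φ_j′` written out there).  Ingredients proved here: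
the pointwise transposition of the projection and of the local terms (`inner_closedForm_eq`, `inner_cross_single_neg`), the integrability on `S_j` of the
full variation pairing density (`integrableOn_inner_integral_variation`) and of the slip density.  Summing over `j` and exchanging the finite sums (so that
each `Y_k` is paired with ONE weight `(DT)^*ψ_k` on `S_k`) is the last, purely finite-sum, step of census item (a) (memo
STRUCTURE-23612-conformal-cokernel-leafhand8-g1.md); instantiating `c_k, m_k = κ·Aa_k, U_k = {‖X_k‖ < 2ℓ}` from the clause block is mechanical
(`…Clause13LinearisedMapClauses`).

Hand `leafhand-ns-filamentskeletonrs-10-g0` (LAND-ONLY); `--supports stmt-NavierStokesRegularity-23612` helper.  HONEST FRAMING: calculus at a HYPOTHETICAL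
near-straight filament skeleton on the NEGATIVE side of a MODEL blow-up route; STUB R is NOT proved here and nothing in this file bears on Navier–Stokes
regularity or blow-up.
-/

noncomputable section

open MeasureTheory Filter Topology Set
open scoped RealInnerProductSpace InnerProductSpace BigOperators
open Literature.Analysis.FluidPDE
open Summit.NavierStokesRegularity.NavierStokesRegularity.Theorems.Clause13RSlipAdjoint (setIntegral_inner_slip_eq deriv_eq_zero_of_not_mem_ball)
open Summit.NavierStokesRegularity.NavierStokesRegularity.Theorems.Clause13RPairwiseAdjoint
open Summit.NavierStokesRegularity.NavierStokesRegularity.Theorems.Clause13RStationContinuity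
open Summit.NavierStokesRegularity.NavierStokesRegularity.Theorems.Clause13RPairIntegrated

namespace Summit.NavierStokesRegularity.NavierStokesRegularity.Theorems.Clause13RClosedFormAdjoint
set_option linter.dupNamespace false

/-! ## §1 Pointwise transpositions -/

/-- Transposing the tangential projection: `⟪ψ, (V − ⟪V,t⟫t) + s⟫ = ⟪ψ − ⟪ψ,t⟫t, V⟫ + ⟪ψ, s⟫`. [folklore] -/
theorem inner_closedForm_eq (ψ V t s : EuclideanSpace ℝ (Fin 3)) :
    ⟪ψ, V - ⟪V, t⟫ • t + s⟫ = ⟪ψ - ⟪ψ, t⟫ • t, V⟫ + ⟪ψ, s⟫ := by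
  rw [inner_add_right, inner_sub_right, inner_smul_right, inner_sub_left, inner_smul_left, real_inner_comm t V,
    real_inner_comm t ψ]
  simp only [conj_trivial]
  ring

/-- `⟪φ, e × y⟫ = −⟪e × φ, y⟫`. [folklore] -/
theorem inner_cross_single_neg (φ e y : EuclideanSpace ℝ (Fin 3)) : ⟪φ, cross e y⟫ = -⟪cross e φ, y⟫ := by
  simp only [cross, cross_apply, PiLp.inner_apply, RCLike.inner_apply, conj_trivial, Fin.sum_univ_three,
    Matrix.cons_val_zero, Matrix.cons_val_one, Matrix.cons_val_two, Matrix.head_cons, Matrix.tail_cons]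
  ring

/-- Transposing the local zeroth-order terms and distributing over the circulation-weighted sum:
`⟪φ, Σ_k c_k•J_k + ½y − α e×y⟫ = Σ_k c_k ⟪φ, J_k⟫ + ⟪½φ + α e×φ, y⟫`. [folklore] -/
theorem inner_velocityPart_eq {N : ℕ} (φ y e : EuclideanSpace ℝ (Fin 3)) (cc : Fin N → ℝ) (J : Fin N → EuclideanSpace ℝ (Fin 3)) (α : ℝ) :
    ⟪φ, (∑ k, cc k • J k) + (1 / 2 : ℝ) • y - α • cross e y⟫ = (∑ k, cc k * ⟪φ, J k⟫) + ⟪(1 / 2 : ℝ) • φ + α • cross e φ, y⟫ := by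
  rw [inner_sub_right, inner_add_right, inner_sum, inner_smul_right, inner_smul_right, inner_cross_single_neg,
    inner_add_left, inner_smul_left, inner_smul_left]
  simp only [inner_smul_right, conj_trivial]
  ring

/-! ## §2 Integrability on the ball of the full variation pairing density and of the slip densities -/

/-- The full variation pairing density `τ ↦ ⟪φτ, ∫ I_{jk}(τ,σ) dσ⟫` is integrable on a compact ball. [folklore] -/
theorem integrableOn_inner_integral_variation {S : Set ℝ} (hS : IsCompact S) {y φ YJ X Y : ℝ → EuclideanSpace ℝ (Fin 3)} {m : ℝ → ℝ}
    {m₀ c C R : ℝ} (hy : Continuous y) (hφ : Continuous φ) (hYJ : Continuous YJ) (hyS : ∀ τ ∈ S, ‖y τ‖ ≤ R)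
    (hm₀ : 0 < m₀) (hm : ∀ σ, m₀ ≤ m σ) (hmc : Continuous m) (hc : 0 < c) (hX : ContDiff ℝ 1 X) (hX1 : ∀ σ, ‖deriv X σ‖ ≤ 1)
    (hXg : ∀ σ, c * |σ| - C ≤ ‖X σ‖) (hY : ContDiff ℝ 1 Y) (hYc : HasCompactSupport Y) :
    IntegrableOn (fun τ => ⟪φ τ, ∫ σ, ((-3 * ⟪y τ - X σ, YJ τ - Y σ⟫ * ((‖y τ - X σ‖ ^ 2 + m σ) ^ (5 / 2 : ℝ))⁻¹) • cross (deriv X σ) (y τ - X σ)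
        + ((‖y τ - X σ‖ ^ 2 + m σ) ^ (3 / 2 : ℝ))⁻¹ • (cross (deriv X σ) (YJ τ - Y σ) + cross (deriv Y σ) (y τ - X σ)))⟫) S := by
  have hmpos : ∀ σ, 0 < m σ := fun σ => hm₀.trans_le (hm σ)
  have i1 := integrableOn_inner_localAdj (φ := φ) (Y := YJ) hS hm₀ hm hmc hc hX hX1 hXg hy hφ hYJ hyS
  have i2 := integrableOn_inner_integral_nonlocal (φ := φ) hS hmc hmpos hX hy hφ hY.continuous hYc
  have i3 := integrableOn_inner_integral_derivTerm (φ := φ) hS hmc hmpos hX hy hφ hY hYc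
  refine ((i1.add i2).add i3).congr_fun (fun τ _ => ?_) hS.measurableSet
  simp only [Pi.add_apply]
  rw [integral_variation_split (y τ) (YJ τ) hm₀ hm hmc hc hX hX1 hXg hY hYc, inner_add_right, inner_add_right,
    inner_integral_local_eq (φ τ) (y τ) (YJ τ) hm₀ hm hmc hc hX hX1 hXg]

/-- The slip pairing density `τ ↦ ⟪ψτ, (w⟪X′,Y′⟫)X′ − wY′⟫` is integrable on a compact set (everything is continuous). [folklore] -/
theorem integrableOn_inner_slip {S : Set ℝ} (hS : IsCompact S) {X ψ Y : ℝ → EuclideanSpace ℝ (Fin 3)} {w : ℝ → ℝ}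
    (hX : ContDiff ℝ 1 X) (hw : Continuous w) (hψ : Continuous ψ) (hY : ContDiff ℝ 1 Y) :
    IntegrableOn (fun τ => ⟪ψ τ, (w τ * ⟪deriv X τ, deriv Y τ⟫) • deriv X τ - w τ • deriv Y τ⟫) S := by
  have hX'c : Continuous (deriv X) := hX.continuous_deriv le_rfl
  have hY'c : Continuous (deriv Y) := hY.continuous_deriv le_rfl
  exact (hψ.inner (((hw.mul (hX'c.inner hY'c)).smul hX'c).sub (hw.smul hY'c))).continuousOn.integrableOn_compact hS

/-- The slip ADJOINT density `τ ↦ ⟪w′•Q + w•Q′, Y⟫` (`Q = ψ − ⟪ψ,X′⟫X′`) is integrable on a compact set: `w′` is only measurable and bounded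
(`|w′| ≤ Λ`), the rest continuous. [folklore] -/
theorem integrableOn_inner_slipAdj {S : Set ℝ} (hS : IsCompact S) {X ψ Y : ℝ → EuclideanSpace ℝ (Fin 3)} {w : ℝ → ℝ} {Λ : ℝ}
    (hX : ContDiff ℝ 2 X) (hw : Differentiable ℝ w) (hwΛ : ∀ τ, |deriv w τ| ≤ Λ) (hψ : ContDiff ℝ 1 ψ) (hY : Continuous Y) :
    IntegrableOn (fun τ => ⟪deriv w τ • (ψ τ - ⟪ψ τ, deriv X τ⟫ • deriv X τ)
          + w τ • (deriv ψ τ - (⟪deriv ψ τ, deriv X τ⟫ + ⟪ψ τ, deriv (deriv X) τ⟫) • deriv X τ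
              - ⟪ψ τ, deriv X τ⟫ • deriv (deriv X) τ), Y τ⟫) S := by
  have hX1 : ContDiff ℝ 1 (deriv X) := by
    have h2 : ContDiff ℝ (1 + 1) X := by rw [one_add_one_eq_two]; exact hX
    exact h2.deriv'
  have c1 : Continuous (deriv X) := hX1.continuous
  have c2 : Continuous (deriv (deriv X)) := hX1.continuous_deriv le_rfl
  have c3 : Continuous ψ := hψ.continuous
  have c4 : Continuous (deriv ψ) := hψ.continuous_deriv le_rfl
  have c5 : Continuous w := hw.continuous
  have i31 : Continuous fun τ => ⟪ψ τ, deriv X τ⟫ := c3.inner c1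
  have i41 : Continuous fun τ => ⟪deriv ψ τ, deriv X τ⟫ := c4.inner c1
  have i32 : Continuous fun τ => ⟪ψ τ, deriv (deriv X) τ⟫ := c3.inner c2
  have cQ : Continuous fun τ => ψ τ - ⟪ψ τ, deriv X τ⟫ • deriv X τ := c3.sub (i31.smul c1)
  have cQ' : Continuous fun τ => deriv ψ τ - (⟪deriv ψ τ, deriv X τ⟫ + ⟪ψ τ, deriv (deriv X) τ⟫) • deriv X τ
      - ⟪ψ τ, deriv X τ⟫ • deriv (deriv X) τ := (c4.sub ((i41.add i32).smul c1)).sub (i31.smul c2)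
  -- split: the `w•Q′` part is continuous; the `w′•Q` part is measurable and bounded on the compact set
  have hA : IntegrableOn (fun τ => ⟪w τ • (deriv ψ τ - (⟪deriv ψ τ, deriv X τ⟫ + ⟪ψ τ, deriv (deriv X) τ⟫) • deriv X τ
      - ⟪ψ τ, deriv X τ⟫ • deriv (deriv X) τ), Y τ⟫) S := ((c5.smul cQ').inner hY).continuousOn.integrableOn_compact hS
  have hB : IntegrableOn (fun τ => ⟪deriv w τ • (ψ τ - ⟪ψ τ, deriv X τ⟫ • deriv X τ), Y τ⟫) S := by
    have hQY : Continuous fun τ => ‖ψ τ - ⟪ψ τ, deriv X τ⟫ • deriv X τ‖ * ‖Y τ‖ := cQ.norm.mul hY.norm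
    obtain ⟨C0, hC0⟩ := hS.exists_bound_of_continuousOn hQY.continuousOn
    refine IntegrableOn.of_bound hS.measure_lt_top ?_ (Λ * C0) ?_
    · exact (((stronglyMeasurable_deriv w).smul cQ.stronglyMeasurable).inner hY.stronglyMeasurable).aestronglyMeasurable
    · refine ae_restrict_of_forall_mem hS.measurableSet fun τ hτ => ?_
      have hb := hC0 τ hτ
      rw [Real.norm_eq_abs, abs_of_nonneg (mul_nonneg (norm_nonneg _) (norm_nonneg _))] at hb
      have hC0nn : 0 ≤ C0 := le_trans (mul_nonneg (norm_nonneg _) (norm_nonneg _)) hb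
      calc ‖⟪deriv w τ • (ψ τ - ⟪ψ τ, deriv X τ⟫ • deriv X τ), Y τ⟫‖
          ≤ ‖deriv w τ • (ψ τ - ⟪ψ τ, deriv X τ⟫ • deriv X τ)‖ * ‖Y τ‖ := norm_inner_le_norm _ _
        _ = |deriv w τ| * (‖ψ τ - ⟪ψ τ, deriv X τ⟫ • deriv X τ‖ * ‖Y τ‖) := by rw [norm_smul, Real.norm_eq_abs, mul_assoc]
        _ ≤ Λ * C0 := mul_le_mul (hwΛ τ) hb (mul_nonneg (norm_nonneg _) (norm_nonneg _)) ((abs_nonneg _).trans (hwΛ τ))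
  refine (hB.add hA).congr_fun (fun τ _ => ?_) hS.measurableSet
  simp only [Pi.add_apply]
  rw [inner_add_left]

/-! ## §3 The per-filament adjoint identity for the closed form -/

/-- **THE PER-FILAMENT ADJOINT IDENTITY.**  Filament `j` with `C²` axis `y` (the stations; `‖yτ‖ ≤ ℓ` on its compact ball `S = {‖y‖ ≤ ℓ}`), slip `w`
differentiable with `|w′| ≤ Λ`, own test field `Y_J ∈ C¹` vanishing off the ball, weight `ψ ∈ C¹` with normal projection `φ = ψ − ⟪ψ, y′⟫y′`; partner
data `k ↦ (X_k, Y_k, m_k, a₀_k, U_k)` as in `…Clause13RPairIntegrated` (proper `C¹` axes with `‖X_k′‖ ≤ 1`, cores with floor `m₀` and `= a₀_k` on an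
open `U_k ⊇ tsupport Y_k`, `Y_k ∈ C¹` compactly supported), circulation weights `c_k`, swirl rate `α`. [folklore] -/
theorem setIntegral_inner_closedForm_eq {N : ℕ} {ℓ Λ α m₀ c C : ℝ} {y ψ YJ : ℝ → EuclideanSpace ℝ (Fin 3)} {w : ℝ → ℝ}
    {X Y : Fin N → ℝ → EuclideanSpace ℝ (Fin 3)} {m : Fin N → ℝ → ℝ} {a₀ : Fin N → ℝ} {U : Fin N → Set ℝ} (cc : Fin N → ℝ)
    (hy : ContDiff ℝ 2 y) (hS : IsCompact {σ : ℝ | ‖y σ‖ ≤ ℓ}) (hw : Differentiable ℝ w) (hwΛ : ∀ τ, |deriv w τ| ≤ Λ)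
    (hψ : ContDiff ℝ 1 ψ) (hYJ : ContDiff ℝ 1 YJ) (hYJoff : ∀ τ, ℓ < ‖y τ‖ → YJ τ = 0)
    (hm₀ : 0 < m₀) (hm : ∀ k σ, m₀ ≤ m k σ) (hmc : ∀ k, Continuous (m k)) (ha₀ : ∀ k, 0 < a₀ k) (hU : ∀ k, IsOpen (U k))
    (hmU : ∀ k σ, σ ∈ U k → m k σ = a₀ k) (hc : 0 < c) (hX : ∀ k, ContDiff ℝ 1 (X k)) (hX1 : ∀ k σ, ‖deriv (X k) σ‖ ≤ 1)
    (hXg : ∀ k σ, c * |σ| - C ≤ ‖X k σ‖) (hY : ∀ k, ContDiff ℝ 1 (Y k)) (hYc : ∀ k, HasCompactSupport (Y k))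
    (hYU : ∀ k, tsupport (Y k) ⊆ U k) :
    ∫ τ in {σ : ℝ | ‖y σ‖ ≤ ℓ}, ⟪ψ τ,
        ((∑ k, cc k • ∫ σ, ((-3 * ⟪y τ - X k σ, YJ τ - Y k σ⟫ * ((‖y τ - X k σ‖ ^ 2 + m k σ) ^ (5 / 2 : ℝ))⁻¹) • cross (deriv (X k) σ) (y τ - X k σ)
            + ((‖y τ - X k σ‖ ^ 2 + m k σ) ^ (3 / 2 : ℝ))⁻¹ • (cross (deriv (X k) σ) (YJ τ - Y k σ) + cross (deriv (Y k) σ) (y τ - X k σ))))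
          + (1 / 2 : ℝ) • YJ τ - α • cross (EuclideanSpace.single 2 1) (YJ τ))
        - ⟪(∑ k, cc k • ∫ σ, ((-3 * ⟪y τ - X k σ, YJ τ - Y k σ⟫ * ((‖y τ - X k σ‖ ^ 2 + m k σ) ^ (5 / 2 : ℝ))⁻¹) • cross (deriv (X k) σ) (y τ - X k σ)
            + ((‖y τ - X k σ‖ ^ 2 + m k σ) ^ (3 / 2 : ℝ))⁻¹ • (cross (deriv (X k) σ) (YJ τ - Y k σ) + cross (deriv (Y k) σ) (y τ - X k σ))))
          + (1 / 2 : ℝ) • YJ τ - α • cross (EuclideanSpace.single 2 1) (YJ τ), deriv y τ⟫ • deriv y τ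
        + ((w τ * ⟪deriv y τ, deriv YJ τ⟫) • deriv y τ - w τ • deriv YJ τ)⟫
      = (∑ k, cc k * ((∫ τ in {σ : ℝ | ‖y σ‖ ≤ ℓ}, ⟪∫ σ, ((-3 * ((‖y τ - X k σ‖ ^ 2 + m k σ) ^ (5 / 2 : ℝ))⁻¹
              * ⟪ψ τ - ⟪ψ τ, deriv y τ⟫ • deriv y τ, cross (deriv (X k) σ) (y τ - X k σ)⟫) • (y τ - X k σ)
              + ((‖y τ - X k σ‖ ^ 2 + m k σ) ^ (3 / 2 : ℝ))⁻¹ • cross (ψ τ - ⟪ψ τ, deriv y τ⟫ • deriv y τ) (deriv (X k) σ)), YJ τ⟫)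
          + (∫ σ, ⟪∫ τ in {σ : ℝ | ‖y σ‖ ≤ ℓ}, ((3 * ((‖y τ - X k σ‖ ^ 2 + m k σ) ^ (5 / 2 : ℝ))⁻¹
              * ⟪ψ τ - ⟪ψ τ, deriv y τ⟫ • deriv y τ, cross (deriv (X k) σ) (y τ - X k σ)⟫) • (y τ - X k σ)
              - ((‖y τ - X k σ‖ ^ 2 + m k σ) ^ (3 / 2 : ℝ))⁻¹ • cross (ψ τ - ⟪ψ τ, deriv y τ⟫ • deriv y τ) (deriv (X k) σ)), Y k σ⟫)
          - ∫ σ, ⟪∫ τ in {σ : ℝ | ‖y σ‖ ≤ ℓ}, ((3 * ⟪y τ - X k σ, deriv (X k) σ⟫ * ((‖y τ - X k σ‖ ^ 2 + a₀ k) ^ (5 / 2 : ℝ))⁻¹)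
                • cross (ψ τ - ⟪ψ τ, deriv y τ⟫ • deriv y τ) (X k σ - y τ)
              + ((‖y τ - X k σ‖ ^ 2 + a₀ k) ^ (3 / 2 : ℝ))⁻¹ • cross (ψ τ - ⟪ψ τ, deriv y τ⟫ • deriv y τ) (deriv (X k) σ)), Y k σ⟫))
        + (∫ τ in {σ : ℝ | ‖y σ‖ ≤ ℓ}, ⟪(1 / 2 : ℝ) • (ψ τ - ⟪ψ τ, deriv y τ⟫ • deriv y τ)
            + α • cross (EuclideanSpace.single 2 1) (ψ τ - ⟪ψ τ, deriv y τ⟫ • deriv y τ), YJ τ⟫)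
        + ∫ τ in {σ : ℝ | ‖y σ‖ ≤ ℓ}, ⟪deriv w τ • (ψ τ - ⟪ψ τ, deriv y τ⟫ • deriv y τ)
            + w τ • (deriv ψ τ - (⟪deriv ψ τ, deriv y τ⟫ + ⟪ψ τ, deriv (deriv y) τ⟫) • deriv y τ
                - ⟪ψ τ, deriv y τ⟫ • deriv (deriv y) τ), YJ τ⟫ := by
  have hy1 : ContDiff ℝ 1 y := hy.of_le (by norm_num)
  have hyc : Continuous y := hy.continuous
  have hy'c : Continuous (deriv y) := hy.continuous_deriv (by norm_num)
  have hψc : Continuous ψ := hψ.continuous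
  have hYJc : Continuous YJ := hYJ.continuous
  -- the normal projection of the weight is continuous
  have hφc : Continuous fun τ => ψ τ - ⟪ψ τ, deriv y τ⟫ • deriv y τ := by
    have hi : Continuous fun τ => ⟪ψ τ, deriv y τ⟫ := hψc.inner hy'c
    exact hψc.sub (hi.smul hy'c)
  have hyS : ∀ τ ∈ {σ : ℝ | ‖y σ‖ ≤ ℓ}, ‖y τ‖ ≤ ℓ := fun τ hτ => hτ
  -- Step 1: pointwise transposition of the projection, the local terms and the sum over `k`
  have hptw : ∀ τ, ⟪ψ τ,
        ((∑ k, cc k • ∫ σ, ((-3 * ⟪y τ - X k σ, YJ τ - Y k σ⟫ * ((‖y τ - X k σ‖ ^ 2 + m k σ) ^ (5 / 2 : ℝ))⁻¹) • cross (deriv (X k) σ) (y τ - X k σ)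
            + ((‖y τ - X k σ‖ ^ 2 + m k σ) ^ (3 / 2 : ℝ))⁻¹ • (cross (deriv (X k) σ) (YJ τ - Y k σ) + cross (deriv (Y k) σ) (y τ - X k σ))))
          + (1 / 2 : ℝ) • YJ τ - α • cross (EuclideanSpace.single 2 1) (YJ τ))
        - ⟪(∑ k, cc k • ∫ σ, ((-3 * ⟪y τ - X k σ, YJ τ - Y k σ⟫ * ((‖y τ - X k σ‖ ^ 2 + m k σ) ^ (5 / 2 : ℝ))⁻¹) • cross (deriv (X k) σ) (y τ - X k σ)
            + ((‖y τ - X k σ‖ ^ 2 + m k σ) ^ (3 / 2 : ℝ))⁻¹ • (cross (deriv (X k) σ) (YJ τ - Y k σ) + cross (deriv (Y k) σ) (y τ - X k σ))))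
          + (1 / 2 : ℝ) • YJ τ - α • cross (EuclideanSpace.single 2 1) (YJ τ), deriv y τ⟫ • deriv y τ
        + ((w τ * ⟪deriv y τ, deriv YJ τ⟫) • deriv y τ - w τ • deriv YJ τ)⟫
      = (∑ k, cc k * ⟪ψ τ - ⟪ψ τ, deriv y τ⟫ • deriv y τ,
            ∫ σ, ((-3 * ⟪y τ - X k σ, YJ τ - Y k σ⟫ * ((‖y τ - X k σ‖ ^ 2 + m k σ) ^ (5 / 2 : ℝ))⁻¹) • cross (deriv (X k) σ) (y τ - X k σ)
            + ((‖y τ - X k σ‖ ^ 2 + m k σ) ^ (3 / 2 : ℝ))⁻¹ • (cross (deriv (X k) σ) (YJ τ - Y k σ) + cross (deriv (Y k) σ) (y τ - X k σ)))⟫)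
        + ⟪(1 / 2 : ℝ) • (ψ τ - ⟪ψ τ, deriv y τ⟫ • deriv y τ)
            + α • cross (EuclideanSpace.single 2 1) (ψ τ - ⟪ψ τ, deriv y τ⟫ • deriv y τ), YJ τ⟫
        + ⟪ψ τ, (w τ * ⟪deriv y τ, deriv YJ τ⟫) • deriv y τ - w τ • deriv YJ τ⟫ := by
    intro τ
    rw [inner_closedForm_eq, inner_velocityPart_eq]
  rw [integral_congr_ae (μ := volume.restrict {σ : ℝ | ‖y σ‖ ≤ ℓ}) (Eventually.of_forall fun τ => hptw τ)]
  -- Step 2: linearity over `S`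
  have iK : ∀ k, IntegrableOn (fun τ => cc k * ⟪ψ τ - ⟪ψ τ, deriv y τ⟫ • deriv y τ,
        ∫ σ, ((-3 * ⟪y τ - X k σ, YJ τ - Y k σ⟫ * ((‖y τ - X k σ‖ ^ 2 + m k σ) ^ (5 / 2 : ℝ))⁻¹) • cross (deriv (X k) σ) (y τ - X k σ)
            + ((‖y τ - X k σ‖ ^ 2 + m k σ) ^ (3 / 2 : ℝ))⁻¹ • (cross (deriv (X k) σ) (YJ τ - Y k σ) + cross (deriv (Y k) σ) (y τ - X k σ)))⟫) {σ : ℝ | ‖y σ‖ ≤ ℓ} :=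
    fun k => (integrableOn_inner_integral_variation hS hyc hφc hYJc hyS hm₀ (hm k) (hmc k) hc (hX k) (hX1 k) (hXg k) (hY k) (hYc k)).const_mul _
  have iSum : IntegrableOn (fun τ => ∑ k, cc k * ⟪ψ τ - ⟪ψ τ, deriv y τ⟫ • deriv y τ,
        ∫ σ, ((-3 * ⟪y τ - X k σ, YJ τ - Y k σ⟫ * ((‖y τ - X k σ‖ ^ 2 + m k σ) ^ (5 / 2 : ℝ))⁻¹) • cross (deriv (X k) σ) (y τ - X k σ)
            + ((‖y τ - X k σ‖ ^ 2 + m k σ) ^ (3 / 2 : ℝ))⁻¹ • (cross (deriv (X k) σ) (YJ τ - Y k σ) + cross (deriv (Y k) σ) (y τ - X k σ)))⟫) {σ : ℝ | ‖y σ‖ ≤ ℓ} :=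
    integrable_finsetSum (μ := volume.restrict {σ : ℝ | ‖y σ‖ ≤ ℓ}) Finset.univ fun k _ => iK k
  have hl1 : Continuous fun τ => (1 / 2 : ℝ) • (ψ τ - ⟪ψ τ, deriv y τ⟫ • deriv y τ) := hφc.const_smul (1 / 2 : ℝ)
  have hl2 : Continuous fun τ => α • cross (EuclideanSpace.single 2 1) (ψ τ - ⟪ψ τ, deriv y τ⟫ • deriv y τ) :=
    ((crossCLM (EuclideanSpace.single 2 1)).continuous.comp hφc).const_smul α
  have hl3 : Continuous fun τ => ⟪(1 / 2 : ℝ) • (ψ τ - ⟪ψ τ, deriv y τ⟫ • deriv y τ)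
        + α • cross (EuclideanSpace.single 2 1) (ψ τ - ⟪ψ τ, deriv y τ⟫ • deriv y τ), YJ τ⟫ := (hl1.add hl2).inner hYJc
  have iLoc : IntegrableOn (fun τ => ⟪(1 / 2 : ℝ) • (ψ τ - ⟪ψ τ, deriv y τ⟫ • deriv y τ)
        + α • cross (EuclideanSpace.single 2 1) (ψ τ - ⟪ψ τ, deriv y τ⟫ • deriv y τ), YJ τ⟫) {σ : ℝ | ‖y σ‖ ≤ ℓ} :=
    hl3.continuousOn.integrableOn_compact hS
  have iSlip := integrableOn_inner_slip hS hy1 hw.continuous hψc hYJ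
  have iSL : IntegrableOn (fun τ => (∑ k, cc k * ⟪ψ τ - ⟪ψ τ, deriv y τ⟫ • deriv y τ,
        ∫ σ, ((-3 * ⟪y τ - X k σ, YJ τ - Y k σ⟫ * ((‖y τ - X k σ‖ ^ 2 + m k σ) ^ (5 / 2 : ℝ))⁻¹) • cross (deriv (X k) σ) (y τ - X k σ)
            + ((‖y τ - X k σ‖ ^ 2 + m k σ) ^ (3 / 2 : ℝ))⁻¹ • (cross (deriv (X k) σ) (YJ τ - Y k σ) + cross (deriv (Y k) σ) (y τ - X k σ)))⟫)
        + ⟪(1 / 2 : ℝ) • (ψ τ - ⟪ψ τ, deriv y τ⟫ • deriv y τ)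
            + α • cross (EuclideanSpace.single 2 1) (ψ τ - ⟪ψ τ, deriv y τ⟫ • deriv y τ), YJ τ⟫) {σ : ℝ | ‖y σ‖ ≤ ℓ} := iSum.add iLoc
  rw [integral_add iSL iSlip, integral_add iSum iLoc, integral_finsetSum _ fun k _ => iK k]
  -- Step 3: each pair `(j, k)` and the slip term
  have hpair : ∀ k, ∫ τ in {σ : ℝ | ‖y σ‖ ≤ ℓ}, cc k * ⟪ψ τ - ⟪ψ τ, deriv y τ⟫ • deriv y τ,
        ∫ σ, ((-3 * ⟪y τ - X k σ, YJ τ - Y k σ⟫ * ((‖y τ - X k σ‖ ^ 2 + m k σ) ^ (5 / 2 : ℝ))⁻¹) • cross (deriv (X k) σ) (y τ - X k σ)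
            + ((‖y τ - X k σ‖ ^ 2 + m k σ) ^ (3 / 2 : ℝ))⁻¹ • (cross (deriv (X k) σ) (YJ τ - Y k σ) + cross (deriv (Y k) σ) (y τ - X k σ)))⟫
      = cc k * ((∫ τ in {σ : ℝ | ‖y σ‖ ≤ ℓ}, ⟪∫ σ, ((-3 * ((‖y τ - X k σ‖ ^ 2 + m k σ) ^ (5 / 2 : ℝ))⁻¹
              * ⟪ψ τ - ⟪ψ τ, deriv y τ⟫ • deriv y τ, cross (deriv (X k) σ) (y τ - X k σ)⟫) • (y τ - X k σ)
              + ((‖y τ - X k σ‖ ^ 2 + m k σ) ^ (3 / 2 : ℝ))⁻¹ • cross (ψ τ - ⟪ψ τ, deriv y τ⟫ • deriv y τ) (deriv (X k) σ)), YJ τ⟫)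
          + (∫ σ, ⟪∫ τ in {σ : ℝ | ‖y σ‖ ≤ ℓ}, ((3 * ((‖y τ - X k σ‖ ^ 2 + m k σ) ^ (5 / 2 : ℝ))⁻¹
              * ⟪ψ τ - ⟪ψ τ, deriv y τ⟫ • deriv y τ, cross (deriv (X k) σ) (y τ - X k σ)⟫) • (y τ - X k σ)
              - ((‖y τ - X k σ‖ ^ 2 + m k σ) ^ (3 / 2 : ℝ))⁻¹ • cross (ψ τ - ⟪ψ τ, deriv y τ⟫ • deriv y τ) (deriv (X k) σ)), Y k σ⟫)
          - ∫ σ, ⟪∫ τ in {σ : ℝ | ‖y σ‖ ≤ ℓ}, ((3 * ⟪y τ - X k σ, deriv (X k) σ⟫ * ((‖y τ - X k σ‖ ^ 2 + a₀ k) ^ (5 / 2 : ℝ))⁻¹)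
                • cross (ψ τ - ⟪ψ τ, deriv y τ⟫ • deriv y τ) (X k σ - y τ)
              + ((‖y τ - X k σ‖ ^ 2 + a₀ k) ^ (3 / 2 : ℝ))⁻¹ • cross (ψ τ - ⟪ψ τ, deriv y τ⟫ • deriv y τ) (deriv (X k) σ)), Y k σ⟫) := by
    intro k
    rw [integral_const_mul, setIntegral_inner_integral_variation_eq hS (hU k) hyc hφc hYJc hyS hm₀ (hm k) (hmc k) (ha₀ k)
      (hmU k) hc (hX k) (hX1 k) (hXg k) (hY k) (hYc k) (hYU k)]
  rw [Finset.sum_congr rfl fun k _ => hpair k, setIntegral_inner_slip_eq hy hw hwΛ hψ hYJ hS hYJoff]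

end Summit.NavierStokesRegularity.NavierStokesRegularity.Theorems.Clause13RClosedFormAdjoint

end
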